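import Summits.QuantumFields.BalabanUV.Beta.CombMixedT2SiteLetter

/-!
# `BalabanUV.Beta.CombMixedT2SiteLetterScaled` — row D1 ∕ (C1), RULING R-D1-g56-3 (+A-1∕A-2): **THE (T2-M₂) SITE LETTER AT A JOINTLY RE-WEIGHTED Λ GROUP** —
# the mixed table scaled by a weight `w` and the multiplier pin at the HOMOGENEOUS lock `cΛ·Lc⁴ = 2·w` obey the SAME commutator law (remainder scaled by `w`)

WHY ([AN2-G56-R3] l.62817, -A1 l.62828, -A2 l.62837; leaf-01 g41 A-1∕A-2, leaf-03 g49 N-1, d1-p2 g29 F-g29-1): by value the typed (III′) literal's Λ group (first-order Λ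
slot `cΛ·SLam`, multiplier table `M1Of … cΛ`, mixed slot `M2Of mixFF`) is the genuine multiplier-Hessian class C in SHAPE and SIGN at scale `4∕Lc¹²` — its internal RATIO (the lock
`cΛ·Lc⁴ = 2` against the mixed slot's convention weight `1`) is RIGHT, its ABSOLUTE weight is short; the consistent pins are `cΛ′ = Lc⁸∕2 = |cVH|`, `wM2′ = Lc¹²∕4 = |cB|`.  The (III″) root therefore
re-instantiates ROOT M‴'s chain at the jointly scaled group `(cΛ′, wM2′•mixFF)`; this file supplies the one Λ∕mixed letter that chain consumes in a `cΛ`-dependent form —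
`CombMixedT2SiteLetter.divV_mixedT2_site_of_lock` — at the HOMOGENEOUS lock `cΛ·Lc⁴ = 2·w` for an ARBITRARY weight `w` on the mixed table (w = 1 is the landed letter; w = Lc¹²∕4, cΛ = Lc⁸∕2 the
(III″) instance).  [folklore] linearity over the landed raw law `divV_mixedT2_site_raw`; nothing of Bałaban's asserted; no table VALUE asserted; no pin asserted (both displayed).
WHAT THIS IS NOT: not the root; not a claim that `w = Lc¹²∕4` (that is the by-value gate `R-AN2-56-ATK`'s to confirm and the root's to display); RECORD (ROOT M‴ p325680) unchanged; 0∕4 row-D1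
binders; NOT D1, NEVER «G-an2-4 closed», NOT BetaPertH, NOT continuum, NOT Clay.

HONEST DEPENDENCY (page 1, mandatory): continuum YM on T⁴ ⇐ BetaPertH ∧ nine spine estimates (0/9 proved); BetaPertH ⇐ (D1) ∧ (D4) ∧ CAP+tail;
G-an2-4 gates asym, D1 and NE2/3/4.  Row D1 ∕ (C1) OWNER an2, gen 56, 2026-08-25.  No existing file touched.
-/

noncomputable section

open Literature.MathematicalPhysics.QuantumFieldTheory
open Literature.MathematicalPhysics.QuantumFieldTheory.Balaban1983to89
open Literature.MathematicalPhysics.QuantumFieldTheory.Balaban1983to89.Beta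
open ExpKernelCalculus (MKer comp)
open OneStepResolventKernel (Fib)
open KernelWard (divV)
open AveragingContoursRooted (ctr)
open BalabanStepW2 (M2Of wM1 wM2)
open Summit.QuantumFields.BalabanUV.Beta.BorderedHessian (diagK stepScale stepScale_ne_zero comp_diagK_left comp_diagK_right)
open Summit.QuantumFields.BalabanUV.Beta.AveragingWardRootedStencils (legInd)
open Summit.QuantumFields.BalabanUV.Beta.SpineRooted (M1Of M1Of_apply)
open Summit.QuantumFields.BalabanUV.Beta.WardLocusStencils (divV_apply)
open Summit.QuantumFields.BalabanUV.Beta.WardLocusParityLevels (M2Of_apply)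
open Summit.QuantumFields.BalabanUV.Beta.SymAveragingHessianCounts (symHessFFAt)
open Summit.QuantumFields.BalabanUV.Beta.SymAveragingMixedJetTables (symMixFFAt)
open Summit.QuantumFields.BalabanUV.Beta.CombMixedT2SiteLetter (divV_mixedT2_site_raw)

namespace Summit.QuantumFields.BalabanUV.Beta.CombMixedT2SiteLetterScaled

variable {Lc : ℕ} [NeZero Lc]

/-- [folklore] The mixed table re-weighted by `w`: `wmix w κ u ρ′ w′ := w • symMixFFAt ρ_c Lc κ u ρ′ w′` (a data slot for `M2Of`; `w = 1` is the landed literal's table). -/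
def wmix (Lc : ℕ) (w : ℝ) : Fin 4 → (Fin 4 → ℤ) → Fin 4 → (Fin 4 → ℤ) → MKer 4 (Fib 3) :=
  fun κ u ρ' w' => w • symMixFFAt (ctr 4 Lc) Lc κ u ρ' w'

omit [NeZero Lc] in
/-- [folklore] Unfolding. -/
theorem wmix_apply (w : ℝ) (κ : Fin 4) (u : Fin 4 → ℤ) (ρ' : Fin 4) (w' : Fin 4 → ℤ) :
    wmix Lc w κ u ρ' w' = w • symMixFFAt (ctr 4 Lc) Lc κ u ρ' w' := rfl

omit [NeZero Lc] in
/-- [folklore] `w = 1` is the literal's own mixed table. -/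
theorem wmix_one : wmix Lc 1 = symMixFFAt (ctr 4 Lc) Lc := by
  funext κ u ρ' w'; rw [wmix_apply, one_smul]

omit [NeZero Lc] in
/-- [folklore] The mixed-slot divergence is LINEAR in the table weight:
`divV (M2Of (wmix w) j · · ρ′ w′) u₀ = w • divV (M2Of symMixFFAt j · · ρ′ w′) u₀`. -/
theorem divV_M2Of_wmix (w : ℝ) (j : ℕ) (ρ' : Fin 4) (w' u₀ : Fin 4 → ℤ) :
    divV (fun κ u => M2Of 3 Lc (wmix Lc w) j κ u ρ' w') u₀ =
      w • divV (fun κ u => M2Of 3 Lc (symMixFFAt (ctr 4 Lc) Lc) j κ u ρ' w') u₀ := by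
  funext x z a b
  rw [divV_apply, Pi.smul_apply, Pi.smul_apply, Pi.smul_apply, Pi.smul_apply, smul_eq_mul, divV_apply, Finset.mul_sum]
  refine Finset.sum_congr rfl fun κ _ => ?_
  simp only [M2Of_apply, wmix_apply, Pi.smul_apply, smul_eq_mul]
  ring

/-- [folklore] **(T2-M₂) PER FINE SITE AT THE HOMOGENEOUS Λ-LOCK `cΛ·Lc⁴ = 2·w`, MIXED TABLE RE-WEIGHTED BY `w`** — the commutator form of
`CombMixedT2SiteLetter.divV_mixedT2_site_of_lock` with the multiplier table `M1Of … cΛ` and the remainder scaled by `w`: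
`c_j • divV (M2Of (wmix w) j … ρ′ w′) u₀ = comp (M1Of … cΛ j ρ′ w′) (diagK (½•legInd)) − comp (diagK (½•legInd)) (M1Of … cΛ j ρ′ w′) + (w·wM1_j∕Lc⁴) • R`.
At `w = 1` this is the landed letter; at `(cΛ, w) = (Lc⁸∕2, Lc¹²∕4)` it is the (III″) instance. -/
theorem divV_mixedT2_site_of_lock_scaled {cΛ w : ℝ} (hΛ : cΛ * (Lc : ℝ) ^ 4 = 2 * w) (j : ℕ) (ρ' : Fin 4) (w' u₀ : Fin 4 → ℤ) :
    (stepScale 3 Lc j * (Lc : ℝ) ^ (3 + 1))⁻¹ • divV (fun κ u => M2Of 3 Lc (wmix Lc w) j κ u ρ' w') u₀ =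
      comp (M1Of 3 Lc (symHessFFAt (ctr 4 Lc) Lc) cΛ j ρ' w') (diagK ((1 / 2 : ℝ) • legInd (ctr 4 Lc) u₀))
        - comp (diagK ((1 / 2 : ℝ) • legInd (ctr 4 Lc) u₀)) (M1Of 3 Lc (symHessFFAt (ctr 4 Lc) Lc) cΛ j ρ' w')
        + (w * wM1 3 Lc j / (Lc : ℝ) ^ 4) •
            ((2 * (if u₀ = (Lc : ℤ) • w' + ctr 4 Lc then (1 : ℝ) else 0)) • symHessFFAt (ctr 4 Lc) Lc ρ' w'
              - comp (symHessFFAt (ctr 4 Lc) Lc ρ' w') (diagK (legInd (ctr 4 Lc) u₀))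
              - comp (diagK (legInd (ctr 4 Lc) u₀)) (symHessFFAt (ctr 4 Lc) Lc ρ' w')) := by
  have hL : (Lc : ℝ) ≠ 0 := Nat.cast_ne_zero.2 (NeZero.ne Lc)
  have hc : cΛ = 2 * w / (Lc : ℝ) ^ 4 := by
    rw [eq_div_iff (pow_ne_zero _ hL)]
    exact hΛ
  rw [divV_M2Of_wmix, smul_comm, divV_mixedT2_site_raw]
  funext x z a b
  simp only [Pi.smul_apply, Pi.sub_apply, Pi.add_apply, smul_eq_mul, comp_diagK_left, comp_diagK_right, M1Of_apply, hc]
  ring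

omit [NeZero Lc] in
/-- [folklore] **THE (III″) INSTANCE OF THE LOCK** (the consistent pins of R-D1-g56-3-A2, displayed, not asserted as the literal's): `cΛ′ = Lc⁸∕2`, `w = Lc¹²∕4` satisfy
`cΛ′·Lc⁴ = 2·w`. -/
theorem lock_of_borderWeights : ((Lc : ℝ) ^ 8 / 2) * (Lc : ℝ) ^ 4 = 2 * ((Lc : ℝ) ^ 12 / 4) := by
  ring

/-- [folklore] … and the landed literal's pins `cΛ = 2∕Lc⁴`, `w = 1` satisfy it too (`Lc ≠ 0`). -/
theorem lock_of_typedWeights : (2 / (Lc : ℝ) ^ 4) * (Lc : ℝ) ^ 4 = 2 * (1 : ℝ) := by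
  have hL : (Lc : ℝ) ≠ 0 := Nat.cast_ne_zero.2 (NeZero.ne Lc)
  field_simp

end Summit.QuantumFields.BalabanUV.Beta.CombMixedT2SiteLetterScaled

end
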